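/- Width seat `ym-line-cbag-p1-w2` (prover-ym-line-cbag-p1-w2-g14-0) on the planner-of-record's LINE 6, route `SmallBetaInfraredSplit` (sub QCD):
REGISTERED STUB 1 `stub_irZero` of the birth skeleton of crux `IRBoundSmallBeta` (stmt-QuantumFields-27240), BY NAME — the `β = 0`, `C = 0`
case of the crux (Salmhofer–Seiler Thm 3.21 at the gauge level).  RECORD-rung material (LADDER-YM Q1, QCD side); nothing about `β > 0`, a mass
gap, the continuum or any summit is proved here; the crux stays open (stub 2 `stub_irLipschitz` is the research content). -/
import Summits.QuantumFields.QCD.Theorems.SmallBetaInfraredSplitZeroCouplingDictionary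
import HarnessLib

/-!
# Crux `IRBoundSmallBeta` (stmt-QuantumFields-27240), stub 1: `stub_irZero` — the gauge-level infrared bound at `β = 0`

For `1 ≤ N ≤ 4`, `ν ≥ 4`, every even torus of side `L ≥ 4` and every real `h`:
`Σ_x Σ_y h(x) (−Δh)(y) G_0(x,y) ≤ (2N)² (1/N) ‖h‖²`, where `G_0` is the gauge two-point function `⟨ψ̄ψ(x)ψ̄ψ(y)⟩` at `β = 0`, `m = 0` in the
determinant / propagator representation (verbatim the crux's form).  Proof: the `β = 0` dictionary `G_0(x,y) = (2N)²⟨σ_xσ_y⟩_Λ`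
(`detRep_eq_sq_mul_expect`: `StrongCoupling.detRep_twoPoint_eq_fermiExpect_re` + Salmhofer–Seiler (2.21) `fermiExpect_spinObs`), bilinearity
(`expect_field_mul_field`) and the tree's complex-spin infrared bound `uN_infraredBound` (Thm 3.21 with Remark 4.5:
`⟨σ(h)σ(−Δh)⟩_Λ ≤ N⁻¹‖h‖²`).  [SalmhoferSeiler1991, Thm. 3.21, (2.21), Remark 4.10(1)]
-/

set_option autoImplicit false

noncomputable section

namespace Summit.QuantumFields.QCD.Theorems.SmallBetaInfraredSplit

open MeasureTheory
open Literature.Probability.LatticeModels (TorusSite)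
open Literature.MathematicalPhysics.QuantumFieldTheory
open Literature.MathematicalPhysics.QuantumLattice
open Literature.MathematicalPhysics.QuantumLattice.StrongCoupling
open Literature.MathematicalPhysics.QuantumLattice.StaggeredSingular (D0)
open Literature.MathematicalPhysics.StatisticalMechanics

/-- **STUB 1 of the registered skeleton of crux `IRBoundSmallBeta` (stmt-QuantumFields-27240), proved: the infrared (Gaussian-domination)
bound for the gauge two-point function at `β = 0`, `m = 0` with constant `(2N)²/N`** — Salmhofer–Seiler Thm 3.21 (+ Remark 4.5) read at
the gauge level through (2.21) and the determinant representation.  NOT the crux (`β > 0` is stub 2); nothing about a mass gap. -/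
theorem stub_irZero : ∀ N ν : ℕ, 1 ≤ N → N ≤ 4 → 4 ≤ ν → ∀ (L : ℕ) [NeZero L], Even L → 4 ≤ L → ∀ h : Literature.Probability.LatticeModels.TorusSite ν L → ℝ, ∑ x : Literature.Probability.LatticeModels.TorusSite ν L, ∑ y : Literature.Probability.LatticeModels.TorusSite ν L, h x * (-Literature.MathematicalPhysics.StatisticalMechanics.ComplexSpin.laplacian h y) * (MeasureTheory.integral (Literature.MathematicalPhysics.QuantumFieldTheory.wilsonWeight (d := ν) (L := L) (Literature.MathematicalPhysics.QuantumLattice.unitaryFundamentalRep (Fin N) ℂ) 0) (fun U => (Matrix.det (Literature.MathematicalPhysics.QuantumLattice.staggeredDirac (Literature.MathematicalPhysics.QuantumLattice.unitaryFundamentalRep (Fin N) ℂ) U 0)).re * (let G := (Literature.MathematicalPhysics.QuantumLattice.staggeredDirac (Literature.MathematicalPhysics.QuantumLattice.unitaryFundamentalRep (Fin N) ℂ) U 0)⁻¹; ((∑ a : Fin N, G (x, a) (x, a)) * (∑ b : Fin N, G (y, b) (y, b)) - ∑ a : Fin N, ∑ b : Fin N, G (x, a) (y, b) * G (y, b) (x,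 a)).re)) / MeasureTheory.integral (Literature.MathematicalPhysics.QuantumFieldTheory.wilsonWeight (d := ν) (L := L) (Literature.MathematicalPhysics.QuantumLattice.unitaryFundamentalRep (Fin N) ℂ) 0) (fun U => (Matrix.det (Literature.MathematicalPhysics.QuantumLattice.staggeredDirac (Literature.MathematicalPhysics.QuantumLattice.unitaryFundamentalRep (Fin N) ℂ) U 0)).re)) ≤ (2 * N : ℝ) ^ 2 * (1 / N) * Literature.MathematicalPhysics.StatisticalMechanics.ComplexSpin.normSq h := by
  intro N ν hN1 hN4 hν L _ hE hL4 h
  have hL1 : 1 < L := by omega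
  have hν1 : 1 ≤ ν := by omega
  have hIR := (uN_infraredBound ν L N hE hL4 hN1 0 h).1
  rw [expect_field_mul_field] at hIR
  have hpos : (0 : ℝ) ≤ (2 * N : ℝ) ^ 2 := by positivity
  have key : ∑ x : TorusSite ν L, ∑ y : TorusSite ν L, h x * (-ComplexSpin.laplacian h y) *
      ((∫ U, ((D0 U).det).re * (wick2 (D0 U)⁻¹ x y).re
          ∂(wilsonWeight (d := ν) (L := L) (unitaryFundamentalRep (Fin N) ℂ) 0)) /
        (∫ U, ((D0 U).det).re ∂(wilsonWeight (d := ν) (L := L) (unitaryFundamentalRep (Fin N) ℂ) 0))) ≤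
      (2 * N : ℝ) ^ 2 * (1 / N) * ComplexSpin.normSq h := by
    have e : ∑ x : TorusSite ν L, ∑ y : TorusSite ν L, h x * (-ComplexSpin.laplacian h y) *
        ((∫ U, ((D0 U).det).re * (wick2 (D0 U)⁻¹ x y).re
            ∂(wilsonWeight (d := ν) (L := L) (unitaryFundamentalRep (Fin N) ℂ) 0)) /
          (∫ U, ((D0 U).det).re ∂(wilsonWeight (d := ν) (L := L) (unitaryFundamentalRep (Fin N) ℂ) 0))) =
        (2 * N : ℝ) ^ 2 * ∑ x : TorusSite ν L, ∑ y : TorusSite ν L,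
          h x * ComplexSpin.expect N 0 (ComplexSpin.uNBondCoeff N) (MvPolynomial.X x * MvPolynomial.X y) *
            (-ComplexSpin.laplacian h y) := by
      rw [Finset.mul_sum]
      refine Finset.sum_congr rfl fun x _ => ?_
      rw [Finset.mul_sum]
      refine Finset.sum_congr rfl fun y _ => ?_
      rw [detRep_eq_sq_mul_expect hN1 hν1 hE hL1 x y]
      ring
    rw [e]
    calc (2 * N : ℝ) ^ 2 * ∑ x : TorusSite ν L, ∑ y : TorusSite ν L,
          h x * ComplexSpin.expect N 0 (ComplexSpin.uNBondCoeff N) (MvPolynomial.X x * MvPolynomial.X y) *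
            (-ComplexSpin.laplacian h y)
        ≤ (2 * N : ℝ) ^ 2 * (1 / N * ComplexSpin.normSq h) := mul_le_mul_of_nonneg_left hIR hpos
      _ = (2 * N : ℝ) ^ 2 * (1 / N) * ComplexSpin.normSq h := by ring
  exact key

end Summit.QuantumFields.QCD.Theorems.SmallBetaInfraredSplit

end
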